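import Mathlib
import HarnessLib
import Summits.ValiantsHypothesis.ValiantsHypothesis.Theses.MonotoneRestoration
import Literature.Computability.AlgebraicComplexity.ArithCircuit
import Literature.Computability.AlgebraicComplexity.ArithCircuitProofs
import Literature.Computability.AlgebraicComplexity.MonotoneStructure
import Literature.Computability.AlgebraicComplexity.PermanentIrreducible
import Literature.ModelTheory.FiniteModelTheory.CkEquiv
import Summits.ValiantsHypothesis.ValiantsHypothesis.Theorems.MonotoneRestorationMonotoneRestorationQPCosetCount
import Summits.ValiantsHypothesis.ValiantsHypothesis.Theorems.MonotoneRestorationMonotoneRestorationQPSymmetricLB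
import Summits.ValiantsHypothesis.ValiantsHypothesis.Theorems.MonotoneRestorationMonotoneRestorationQPSupportSymmetrisation
import Summits.ValiantsHypothesis.ValiantsHypothesis.Theorems.MonotoneRestorationMonotoneRestorationQPSparseRegime
import Summits.ValiantsHypothesis.ValiantsHypothesis.Theorems.MonotoneRestorationMonotoneRestorationQPBeta
import Literature.Computability.AlgebraicComplexity.SymmetricArithCircuit
import Literature.Computability.AlgebraicComplexity.DawarWilsenach2025Proofs
import Literature.GroupTheory.PermutationGroups.SmallIndexSubgroups
import Summits.ValiantsHypothesis.ValiantsHypothesis.Theorems.MonotoneRestorationQP.Negative.LoadBearing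
import Summits.ValiantsHypothesis.ValiantsHypothesis.Theorems.MonotoneRestorationMonotoneRestorationQPPermSupportCount

/-! TTRL-lite variant V18935 of stmt-ValiantsHypothesis-15886

Target `stub_mulGate_children_extend` (slug `valian15886-stub-mulgate-children-`), move `generalise`
(BOUNDARY): ONE shift `μ` serving BOTH factors of a product simultaneously (`∃ μ, ∀ h` instead of
`∀ h, ∃ μ` in part (1) of the parent) — is FALSE. Witness (one variable `v = (0,0) : Fin 1 × Fin 1`):
`p = 1`, `q = X v`, `f = X v`. Then `p * q = X v ≠ 0` and the hypothesis holds with `μ = 0`; but a common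
shift would need `0 + μ = single v 1` (from `p.support = {0}`) and `single v 1 + μ = single v 1`
(from `q.support = {single v 1}`), i.e. `μ = single v 1` and `μ = 0` at once. So the shift `μ_h` of the
parent genuinely depends on the child `h`.
-/

-- `Summit.ValiantsHypothesis.ValiantsHypothesis.…` is the tree's mandated single-conjunct layout
-- (Sub = Summit), so the duplicated namespace component is intended.
set_option linter.dupNamespace false

namespace Summit.ValiantsHypothesis.ValiantsHypothesis.Theorems

open Summit.ValiantsHypothesis.ValiantsHypothesis.Theses.MonotoneRestoration
open Literature.Computability.AlgebraicComplexity

/-- **TTRL-lite variant V18935 of `stub_mulGate_children_extend` is FALSE** (a single shift `μ`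
extending both factors of `p * q` into `f.support` at once). Witness: `v = (0,0) : Fin 1 × Fin 1`,
`p = 1`, `q = X v`, `f = X v`: `p * q = X v ≠ 0`, the extension hypothesis holds with `μ = 0`
(`(X v).support = {single v 1} = f.support`), but `p.support = {0}` forces `μ = single v 1` while
`q.support = {single v 1}` forces `single v 1 + μ = single v 1`, i.e. `μ = 0`; evaluating at `v` gives
`1 + 1 = 1`. Hence in the parent statement the shift must be allowed to depend on the child. -/
theorem stub_mulGate_children_extend_var18935_false :
    ¬ (∀ (p q f : MvPolynomial (Fin 1 × Fin 1) NNReal), p * q ≠ 0 →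
        (∃ μ : (Fin 1 × Fin 1) →₀ ℕ, ∀ m ∈ (p * q).support, m + μ ∈ f.support) →
        ∃ μ : (Fin 1 × Fin 1) →₀ ℕ, (∀ m ∈ p.support, m + μ ∈ f.support) ∧
          (∀ m ∈ q.support, m + μ ∈ f.support)) := by
  intro h
  have hsX : (MvPolynomial.X ((0 : Fin 1), (0 : Fin 1)) :
      MvPolynomial (Fin 1 × Fin 1) NNReal).support = {Finsupp.single ((0 : Fin 1), (0 : Fin 1)) 1} :=
    MvPolynomial.support_X
  have hs1 : (1 : MvPolynomial (Fin 1 × Fin 1) NNReal).support = {0} := MvPolynomial.support_one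
  have hne : (1 : MvPolynomial (Fin 1 × Fin 1) NNReal) * MvPolynomial.X ((0 : Fin 1), (0 : Fin 1))
      ≠ 0 := by
    rw [one_mul]
    exact MvPolynomial.X_ne_zero _
  have hext : ∃ μ : (Fin 1 × Fin 1) →₀ ℕ,
      ∀ m ∈ ((1 : MvPolynomial (Fin 1 × Fin 1) NNReal) *
          MvPolynomial.X ((0 : Fin 1), (0 : Fin 1))).support,
        m + μ ∈ (MvPolynomial.X ((0 : Fin 1), (0 : Fin 1)) :
          MvPolynomial (Fin 1 × Fin 1) NNReal).support := by
    refine ⟨0, fun m hm => ?_⟩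
    rw [one_mul] at hm
    rwa [add_zero]
  obtain ⟨μ, hp, hq⟩ := h 1 (MvPolynomial.X ((0 : Fin 1), (0 : Fin 1)))
    (MvPolynomial.X ((0 : Fin 1), (0 : Fin 1))) hne hext
  have h1 := hp 0 (by rw [hs1]; exact Finset.mem_singleton_self _)
  have h2 := hq (Finsupp.single ((0 : Fin 1), (0 : Fin 1)) 1)
    (by rw [hsX]; exact Finset.mem_singleton_self _)
  rw [hsX, Finset.mem_singleton] at h1 h2
  rw [zero_add] at h1
  rw [h1] at h2
  have h3 := congrArg (fun g : (Fin 1 × Fin 1) →₀ ℕ => g ((0 : Fin 1), (0 : Fin 1))) h2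
  simp only [Finsupp.coe_add, Pi.add_apply, Finsupp.single_eq_same] at h3
  omega

end Summit.ValiantsHypothesis.ValiantsHypothesis.Theorems
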